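import Summits.CriticalPhenomena.PercolationContinuityZ3.Theorems.PercNearOneGluingNoHeavyQuantFarSunSharpLargeK
import HarnessLib

/-!
# FAR beyond trees: **LAYER 3 OF FAR ON ALL HAIRY CYCLES WITH `K ≥ 91` HAIRS** — `HairyCycle.sunFAR_three_of_ge : 91 ≤ K → SunFAR K 3`
# (the layer-`3` instance of the sharp LEMMA 1 with tuned constants; the uniform theorem gives `K ≥ 119`, gen 41 gave `K ≥ 4881`)

builds on p205010 (kernel theorem, internal audit signed; external expert review pending)

Support file (`--supports stmt-CriticalPhenomena-4575`), seat `prim-cert-1` (gen 42); memo `prim-cert-1/FROM-prim-cert-1-g42-SHARP-LARGEK.md` §3.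
`HairyCycle.witGavg_ge_one_sharp` (…QuantFarSunSharpWitAvg) at `j = 3` with `M = 4`, `θ₂ = 1/2`, `ρ = 9/20`, `θ₁ = 2/5`:
* `HairyCycle.witGavg_ge_one_three` — `0 < h ≤ 1` on `range K`, `Σ_{k<K} h k ≥ 18` ⟹ `witGavg K h 3 ≥ 1` (numeric core `sharp_numeric_three`,
  `e^{51/5} ≥ 26800`, `e^{−2} ≤ 0.1354`);
* **`HairyCycle.sunFAR_three_of_ge`** — `SunFAR K 3` for every `K ≥ 91`: on `R_3` with `K ≥ 91`, `Σ ≤ 15` contradicts `3K < Σ(Σ+1)`, and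
  `15 < Σ < 18` contradicts `3KF < Σ(Σ−3)` since then `F ≥ 1 − 64e^{−45/4} ≥ 999/1000` (`jKF_lt_of_R`, `hairV_univ_ge_chernoff`);
* graph forms `farRelayRow_hairyCycle_three_of_ge`, `farRelayRow_ring_three_of_ge`.
With `sunFAR_of_le_eleven`, layer 3 of FAR on hairy cycles / rings is open exactly for `12 ≤ K ≤ 90`.  No definitions, no sorries, standard axioms.  [this work]
[cite: KozmaNitzan2024, Conjecture 3 (p. 15)] (context: the lower-tail family FAR serves).
-/

noncomputable section

namespace Summit.CriticalPhenomena.PercolationContinuityZ3.Theorems.HairyCycle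

open Finset
open scoped Classical

variable {K : ℕ}

/-! ## Numeric lemmas -/

/-- `e^{51/5} ≥ 26800`. [folklore] -/
theorem exp_fiftyone_fifths_ge : (26800 : ℝ) ≤ Real.exp (51 / 5) := by
  have h1 := Real.exp_one_gt_d9
  have h2 := Real.quadratic_le_exp_of_nonneg (show (0 : ℝ) ≤ 1 / 5 by norm_num)
  have e : Real.exp (51 / 5) = Real.exp 1 ^ 10 * Real.exp (1 / 5) := by
    rw [← Real.exp_nat_mul, ← Real.exp_add]; norm_num
  rw [e]
  have h3 : (2.7182818283 : ℝ) ^ 10 ≤ Real.exp 1 ^ 10 := pow_le_pow_left₀ (by norm_num) h1.le 10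
  have h4 : (22026 : ℝ) ≤ (2.7182818283 : ℝ) ^ 10 := by norm_num
  have h5 : (0 : ℝ) ≤ Real.exp (1 / 5) := (Real.exp_pos _).le
  nlinarith

/-- `64·e^{−45/4} ≤ 1/1000` (`e^{45/4} ≥ e^{11}·e^{1/4} ≥ 64000`). [folklore] -/
theorem exp_neg_fortyfive_quarters_le : (64 : ℝ) * Real.exp (-(45 / 4)) ≤ 1 / 1000 := by
  have h1 := Real.exp_one_gt_d9
  have h2 := Real.quadratic_le_exp_of_nonneg (show (0 : ℝ) ≤ 1 / 4 by norm_num)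
  have e : Real.exp (45 / 4) = Real.exp 1 ^ 11 * Real.exp (1 / 4) := by
    rw [← Real.exp_nat_mul, ← Real.exp_add]; norm_num
  have h3 : (2.7182818283 : ℝ) ^ 11 ≤ Real.exp 1 ^ 11 := pow_le_pow_left₀ (by norm_num) h1.le 11
  have h4 : (59000 : ℝ) ≤ (2.7182818283 : ℝ) ^ 11 := by norm_num
  have h5 : (0 : ℝ) ≤ Real.exp (1 / 4) := (Real.exp_pos _).le
  have h6 : (64000 : ℝ) ≤ Real.exp (45 / 4) := by rw [e]; nlinarith
  have hpos : 0 < Real.exp (45 / 4) := Real.exp_pos _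
  rw [Real.exp_neg, ← div_eq_mul_inv, div_le_iff₀ hpos]
  linarith

/-- The flank reliability at layer `3`: `9/20 ≤ 1 − e^{−(1−1/2)·4}/(1/2)^{3−1} = 1 − 4e^{−2}`. [this work] -/
theorem rho_three_le : (9 / 20 : ℝ) ≤ 1 - Real.exp (-(1 - 1 / 2) * 4) / (1 / 2 : ℝ) ^ (3 - 1) := by
  have h := exp_neg_two_le
  rw [show -(1 - 1 / 2 : ℝ) * 4 = -2 by norm_num]
  norm_num
  linarith

/-- **Numeric core of LEMMA 1 at layer 3**: for `S ≥ 18`,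
`e^{−(1 − 2/5)(S−1)}/(2/5)^6 · (S − 5·(9/20)) ≤ (S − 8 − 2 − 6)·(9/20)³`. [this work] -/
theorem sharp_numeric_three {S : ℝ} (hS : 18 ≤ S) :
    Real.exp (-(1 - 2 / 5) * (S - 1)) / (2 / 5 : ℝ) ^ (2 * 3) * (S - (2 * ((3 : ℕ) : ℝ) - 1) * (9 / 20)) ≤
      (S - 2 * 4 - 2 - 2 * ((3 : ℕ) : ℝ)) * (9 / 20 : ℝ) ^ 3 := by
  set u := S - 18 with hu
  have hu0 : 0 ≤ u := by rw [hu]; linarith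
  have hE : (26800 : ℝ) * (1 + 3 * u / 5) ≤ Real.exp ((1 - 2 / 5) * (S - 1)) := by
    have e : (1 - 2 / 5 : ℝ) * (S - 1) = 51 / 5 + 3 * u / 5 := by rw [hu]; ring
    rw [e, Real.exp_add]
    have h3 : 1 + 3 * u / 5 ≤ Real.exp (3 * u / 5) := by linarith [Real.add_one_le_exp (3 * u / 5)]
    exact mul_le_mul exp_fiftyone_fifths_ge h3 (by linarith) (Real.exp_pos _).le
  have hEpos : 0 < Real.exp ((1 - 2 / 5) * (S - 1)) := Real.exp_pos _
  have e2 : Real.exp (-(1 - 2 / 5) * (S - 1)) = 1 / Real.exp ((1 - 2 / 5) * (S - 1)) := by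
    rw [show -(1 - 2 / 5 : ℝ) * (S - 1) = -((1 - 2 / 5) * (S - 1)) by ring, Real.exp_neg, inv_eq_one_div]
  rw [e2]
  rw [show (1 : ℝ) / Real.exp ((1 - 2 / 5) * (S - 1)) / (2 / 5 : ℝ) ^ (2 * 3) * (S - (2 * ((3 : ℕ) : ℝ) - 1) * (9 / 20)) =
      (S - (2 * ((3 : ℕ) : ℝ) - 1) * (9 / 20)) / (2 / 5 : ℝ) ^ (2 * 3) / Real.exp ((1 - 2 / 5) * (S - 1)) by
    field_simp]
  rw [div_le_iff₀ hEpos]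
  have hS' : S = 18 + u := by rw [hu]; ring
  have hrhs0 : (0 : ℝ) ≤ (S - 2 * 4 - 2 - 2 * ((3 : ℕ) : ℝ)) * (9 / 20 : ℝ) ^ 3 := by rw [hS']; push_cast; nlinarith
  calc (S - (2 * ((3 : ℕ) : ℝ) - 1) * (9 / 20)) / (2 / 5 : ℝ) ^ (2 * 3)
      ≤ (S - 2 * 4 - 2 - 2 * ((3 : ℕ) : ℝ)) * (9 / 20 : ℝ) ^ 3 * ((26800 : ℝ) * (1 + 3 * u / 5)) := by
        rw [hS']; push_cast; norm_num
        nlinarith [hu0, mul_nonneg hu0 hu0]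
    _ ≤ (S - 2 * 4 - 2 - 2 * ((3 : ℕ) : ℝ)) * (9 / 20 : ℝ) ^ 3 * Real.exp ((1 - 2 / 5) * (S - 1)) :=
        mul_le_mul_of_nonneg_left hE hrhs0

/-! ## LEMMA 1 at layer 3 -/

/-- **LEMMA 1 at layer 3.**  If `0 < h k ≤ 1` for `k < K` and `Σ_{k<K} h k ≥ 18`, then `witGavg K h 3 ≥ 1` (every `K`). [this work] -/
theorem witGavg_ge_one_three {h : ℕ → ℝ} (hh : ∀ k, k < K → 0 < h k ∧ h k ≤ 1) (hS : (18 : ℝ) ≤ ∑ k ∈ range K, h k) :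
    1 ≤ witGavg K h 3 := by
  refine witGavg_ge_one_sharp hh (j := 3) (by norm_num) (M := 4) (θ₁ := 2 / 5) (θ₂ := 1 / 2) (ρ := 9 / 20)
    (by norm_num) (by norm_num) (by norm_num) (by norm_num) (by norm_num) (by norm_num) rho_three_le ?_ ?_
  · push_cast; linarith
  · exact sharp_numeric_three hS

/-! ## The theorem -/

/-- **LAYER 3 OF FAR ON ALL HAIRY CYCLES WITH `K ≥ 91` HAIRS**: `SunFAR K 3` for every `K ≥ 91` (sun graph, all cycle-edge and hair weights;
hence on every hairy cycle with `K` pendant relays). [this work] -/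
theorem sunFAR_three_of_ge {K : ℕ} (hK : 91 ≤ K) : SunFAR K 3 := by
  have hK2 : 2 ≤ K := by omega
  refine sunFAR_of_witGavg_from_all (j := 3) (by norm_num) K hK2 (fun K' hK' h hh m hm hmin hS2j hR => ?_) K le_rfl
  -- truncate `h` outside `range K'`
  set h' : ℕ → ℝ := fun k => if k < K' then h k else 0 with hh'def
  have he : ∀ k, k < K' → h' k = h k := fun k hk => by rw [hh'def]; simp only [hk, if_true]
  have hh' : ∀ k, 0 ≤ h' k ∧ h' k ≤ 1 := by
    intro k
    by_cases hk : k < K'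
    · rw [he k hk]; exact hh k hk
    · rw [hh'def]; simp only [hk, if_false]; norm_num
  have hsum : ∑ k ∈ range K', h' k = ∑ k ∈ range K', h k :=
    Finset.sum_congr rfl fun k hk => he k (Finset.mem_range.1 hk)
  have hF : hairV K' h' 3 (range K') = hairV K' h 3 (range K') := hairV_congr he 3 (range K')
  have hL2 := jKF_lt_of_R (K := K') hh' (j := 3) (by norm_num) hm (fun k hk => by rw [he m hm, he k hk]; exact hmin k hk)
    (by rw [hsum]; exact hS2j) (by rw [hsum, hF, he m hm]; exact hR)
  rw [hsum, hF, he m hm] at hL2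
  obtain ⟨hjKF, hjK, hηpos⟩ := hL2
  push_cast at hjKF hjK
  set S := ∑ k ∈ range K', h k with hSdef
  set F := hairV K' h 3 (range K') with hFdef
  have hS0 : 0 ≤ S := Finset.sum_nonneg fun k hk => (hh k (Finset.mem_range.1 hk)).1
  have hK'r : (91 : ℝ) ≤ K' := by exact_mod_cast hK.trans hK'
  have hhpos : ∀ k, k < K' → 0 < h k ∧ h k ≤ 1 := fun k hk => ⟨lt_of_lt_of_le hηpos (hmin k hk), (hh k hk).2⟩
  have hSig : (18 : ℝ) ≤ S := by
    by_contra hlt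
    push Not at hlt
    rcases le_or_gt S 15 with hS15 | hS15
    · have h1 : S * (S + 1) ≤ 15 * 16 := by nlinarith
      nlinarith
    · have hF1 := hairV_univ_ge_chernoff hh 3
      rw [← hSdef, ← hFdef] at hF1
      have hexp : (4 : ℝ) ^ 3 * Real.exp (-(3 / 4) * S) ≤ 1 / 1000 := by
        refine le_trans ?_ exp_neg_fortyfive_quarters_le
        rw [show (4 : ℝ) ^ 3 = 64 by norm_num]
        exact mul_le_mul_of_nonneg_left (Real.exp_le_exp.2 (by linarith)) (by norm_num)
      have hF999 : (999 / 1000 : ℝ) ≤ F := by linarith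
      have hK'0 : (0 : ℝ) ≤ 3 * (K' : ℝ) := by positivity
      have h1 : 3 * (K' : ℝ) * (999 / 1000) ≤ 3 * (K' : ℝ) * F := mul_le_mul_of_nonneg_left hF999 hK'0
      have h2 : S * (S - 3) < 18 * 15 := by nlinarith
      nlinarith
  exact witGavg_ge_one_three hhpos hSig

/-! ## Graph forms -/

open MeasureTheory
open Literature.Probability.Percolation Literature.Probability.LatticeModels
open Summit.CriticalPhenomena.PercolationContinuityZ3.Theorems.TwoCopy

/-- **FAR at layer 3 on every hairy cycle with `K ≥ 91` pendant relays**, all weights. [this work] -/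
theorem farRelayRow_hairyCycle_three_of_ge {n L K : ℕ} {cyc : ℕ → Fin n} {base : ℕ → ℕ} {tip : ℕ → Fin n} (H : IsHairyCycle L cyc K base tip)
    (hK : 91 ≤ K) (w : Sym2 (Fin n) → unitInterval)
    (hsupp : ∀ e : Sym2 (Fin n), ¬ e.IsDiag → w e ≠ 0 →
      (∃ i, i < L ∧ e = cycE L cyc i) ∨ (∃ k, k < K ∧ e = hairE cyc base tip k))
    (t : ℝ)
    (hEN : (2 * (3 : ℕ) : ℝ) < ∑ a ∈ (Finset.range K).image tip, (prodBernoulli w).real (openConn (cyc 0) a))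
    (hcut : ∀ a ∈ (Finset.range K).image tip, (prodBernoulli w).real (openConn (cyc 0) a)ᶜ ≤ t) :
    (prodBernoulli w).real {ω : BondConfig (Fin n) |
      (((Finset.range K).image tip).filter fun a => ω ∈ openConn (cyc 0) a).card ≤ 3} ≤ t :=
  farRelayRow_hairyCycle_of_sunFAR H (sunFAR_three_of_ge hK) w hsupp t hEN hcut

/-- **FAR at layer 3 on every RING with `K ≥ 91` relays** (relays at cycle vertices and/or on pendant hairs), all weights supported on the cycle and
proper hair edges. [this work] -/
theorem farRelayRow_ring_three_of_ge {n L K : ℕ} {cyc : ℕ → Fin n} {base : ℕ → ℕ} {tip : ℕ → Fin n} (H : IsHairyCycleD L cyc K base tip)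
    (hK : 91 ≤ K) (w : Sym2 (Fin n) → unitInterval)
    (hsupp : ∀ e : Sym2 (Fin n), ¬ e.IsDiag → w e ≠ 0 →
      (∃ i, i < L ∧ e = cycE L cyc i) ∨ (∃ k, k < K ∧ e = hairE cyc base tip k))
    (t : ℝ)
    (hEN : (2 * (3 : ℕ) : ℝ) < ∑ a ∈ (Finset.range K).image tip, (prodBernoulli w).real (openConn (cyc 0) a))
    (hcut : ∀ a ∈ (Finset.range K).image tip, (prodBernoulli w).real (openConn (cyc 0) a)ᶜ ≤ t) :
    (prodBernoulli w).real {ω : BondConfig (Fin n) |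
      (((Finset.range K).image tip).filter fun a => ω ∈ openConn (cyc 0) a).card ≤ 3} ≤ t :=
  farRelayRow_ring_of_sunFAR H (sunFAR_three_of_ge hK) w hsupp t hEN hcut

end Summit.CriticalPhenomena.PercolationContinuityZ3.Theorems.HairyCycle

end
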